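import Summits.CriticalPhenomena.PercolationContinuityZ3.Theorems.PercNearOneGluingNoHeavyPcintBSMSym3
import HarnessLib

/-!
# PCINT lane, PHASE 6 (block renewal with reach-two pieces): fast key counts and orbit reduction for `t = 2`

Cell `prim-pcint`, seat `prim-pcint-1` (gen 15); memo `run/shared/lean/prim/pcint/T-FIBRE-ROUTE.md` §PHASE 6.

The transverse lattice of PHASE 6 is the plane `ℤ^2`.  This file is the `t = 2` counterpart of …PcintBSMFast3 and
…PcintBSMSym3: the shared transverse key count with integer-pair vertices (`BSMX.S2`, **`BSMX.S_eq_S2`**, fast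
decidable equality in the kernel), the dihedral group of the square acting on offsets (generators `BSMX.gen2`:
`y ↦ -y`, the transposition of the two axes, the sign flip of axis `0`), the orbit reduction of the potential-table
checks (**`BSMX.boxV_of_reps2`**, `[-8,8]^2` → representatives) and of the integer certificate inequalities
(**`BSMX.certZ_of_reps2`**, `[-4,4]^2` → representatives), for piece families closed under the transposition and the
flip with invariant weights and invariant tables (`BSM.certLHS_neg`, `BSM.certLHS_perm`, `BSM.certLHS_flip`).
-/

namespace Summit.CriticalPhenomena.PercolationContinuityZ3.Theorems.Pcint.BSMX

open Finset BSM

variable {k np : ℕ}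

/-! ### Fast shared key counts with integer-pair vertices -/

/-- Coordinates of a vector of `ℤ^2` as a pair. -/
def tr2 (v : Fin 2 → ℤ) : ℤ × ℤ := (v 0, v 1)

/-- `tr2` is injective. -/
theorem tr2_injective : Function.Injective tr2 := by
  intro v w h
  simp only [tr2, Prod.mk.injEq] at h
  funext i
  fin_cases i
  · exact h.1
  · exact h.2

/-- `tr2` is additive. -/
theorem tr2_add (v w : Fin 2 → ℤ) : tr2 (v + w) = tr2 v + tr2 w := rfl

/-- Keys with pair vertices. -/
abbrev LKey2 (k : ℕ) := (ℤ × ℤ) × (Fin 2 ⊕ Fin k)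

/-- Transport of edge keys to pair vertices. -/
def embK2 (k : ℕ) : LKey 2 k ↪ LKey2 k :=
  ⟨fun q => (tr2 q.1, q.2), fun q q' h => by
    simp only [Prod.mk.injEq] at h
    exact Prod.ext (tr2_injective h.1) h.2⟩

/-- The step vector of a signed axis as a pair. -/
def sv2 (q : Fin 2 × Bool) : ℤ × ℤ := tr2 (sv q)

/-- The transverse edge keys of a piece started at the pair `u` (mirror of `BSM.tedges`). -/
def tedges2 (k : ℕ) : ℤ × ℤ → List (Fin 2 × Bool) → Finset (LKey2 k)
  | _, [] => ∅
  | u, q :: σ => insert (if q.2 then (u, Sum.inl q.1) else (u + sv2 q, Sum.inl q.1)) (tedges2 k (u + sv2 q) σ)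

/-- `tedges2` is the transport of `tedges`. -/
theorem tedges_map_embK2 (k : ℕ) : ∀ (u : Fin 2 → ℤ) (σ : List (Fin 2 × Bool)),
    (tedges k u σ).map (embK2 k) = tedges2 k (tr2 u) σ
  | u, [] => by simp [tedges, tedges2]
  | u, q :: σ => by
    rw [tedges, tedges2, Finset.map_insert, tedges_map_embK2 k (u + sv q) σ, tr2_add]
    congr 1
    split_ifs <;> rfl

/-- Shift of pair keys. -/
def shiftE2 (k : ℕ) (y : ℤ × ℤ) : LKey2 k ↪ LKey2 k :=
  ⟨fun q => (q.1 + y, q.2), fun q q' h => by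
    simp only [Prod.mk.injEq, add_left_inj] at h
    exact Prod.ext h.1 h.2⟩

/-- Transport commutes with shifting. -/
theorem shiftE_trans_embK2 (k : ℕ) (y : Fin 2 → ℤ) :
    (shiftE (k := k) y).trans (embK2 k) = (embK2 k).trans (shiftE2 k (tr2 y)) := by
  ext q <;> simp [shiftE, embK2, shiftE2, tr2_add, Function.Embedding.trans]

/-- **The fast shared transverse key count** (integer-pair vertices). -/
def S2 (pc : Fin np → List (Fin 2 × Bool)) (k : ℕ) (y : Fin 2 → ℤ) (σ σ' : Fin np) : ℕ :=
  (tedges2 k (0, 0) (pc σ) ∩ (tedges2 k (0, 0) (pc σ')).map (shiftE2 k (tr2 y))).card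

/-- **`S = S2`.** -/
theorem S_eq_S2 (pc : Fin np → List (Fin 2 × Bool)) (k : ℕ) (y : Fin 2 → ℤ) (σ σ' : Fin np) :
    S pc k y σ σ' = S2 pc k y σ σ' := by
  unfold S S2
  rw [← Finset.card_map (embK2 k), Finset.map_inter, Finset.map_map, shiftE_trans_embK2, ← Finset.map_map,
    tedges_map_embK2, tedges_map_embK2]
  rfl

/-! ### The dihedral group of the square on offsets -/

/-- The generators on offsets of `ℤ^2`: `0 ↦ (y ↦ -y)`, `1 ↦` the transposition `(0 1)`, `2 ↦` the sign flip of
coordinate `0` (together they generate the dihedral group of order 8). -/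
def gen2 (g : Fin 3) (y : Fin 2 → ℤ) : Fin 2 → ℤ :=
  if g = 0 then -y else if g = 1 then pv (Equiv.swap 0 1) y else negC 0 y

/-- Apply a word of generators (rightmost first). -/
def applyW2 (w : List (Fin 3)) (y : Fin 2 → ℤ) : Fin 2 → ℤ := w.foldr gen2 y

/-- A function invariant under the generators is invariant under words. -/
theorem applyW2_invariant' {β : Type*} (f : (Fin 2 → ℤ) → β) (h : ∀ g y, f (gen2 g y) = f y) :
    ∀ (w : List (Fin 3)) (y : Fin 2 → ℤ), f (applyW2 w y) = f y
  | [], _ => rfl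
  | g :: w, y => by
    rw [applyW2, List.foldr_cons, ← applyW2, h g, applyW2_invariant' f h w y]

/-- The generators, explicitly. -/
theorem gen2_apply (y : Fin 2 → ℤ) : gen2 0 y = -y ∧ gen2 1 y = pv (Equiv.swap 0 1) y ∧ gen2 2 y = negC 0 y := by
  unfold gen2; simp

/-- The generators are additive. -/
theorem gen2_sub (g : Fin 3) (z u : Fin 2 → ℤ) : gen2 g z - gen2 g u = gen2 g (z - u) := by
  unfold gen2; split_ifs
  · abel
  · rw [pv_sub]
  · rw [negC_sub]

/-- `canonK` is invariant under the generators. -/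
theorem canonK_gen2 (g : Fin 3) (u : Fin 2 → ℤ) : canonK (gen2 g u) = canonK u := by
  unfold gen2; split_ifs
  · exact canonK_neg u
  · exact canonK_pv _ u
  · exact canonK_negC _ u

/-- The generators permute `[-4,4]^2`. -/
theorem boxList4_perm_gen2 (g : Fin 3) : ((boxList 2 4).map (gen2 g)).Perm (boxList 2 4) := by
  fin_cases g <;> decide +kernel

/-- The potential sums are invariant under the generators. -/
theorem boxSum_gen2 (Gn Φn : (Fin 2 → ℤ) → ℕ) (Tn : ℕ) (hΦ : ∀ g u, Φn (gen2 g u) = Φn u) (g : Fin 3)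
    (u : Fin 2 → ℤ) :
    ((boxList 2 4).map fun z => (Gn (canonK (z - gen2 g u)) + Tn) * Φn z).sum =
      ((boxList 2 4).map fun z => (Gn (canonK (z - u)) + Tn) * Φn z).sum := by
  rw [← ((boxList4_perm_gen2 g).map (fun z => (Gn (canonK (z - gen2 g u)) + Tn) * Φn z)).sum_eq, List.map_map]
  congr 1
  refine List.map_congr_left fun z _ => ?_
  simp only [Function.comp_apply, gen2_sub, canonK_gen2, hΦ]

/-- **Orbit reduction of the potential-table checks** (`[-8,8]^2` → representatives). -/
theorem boxV_of_reps2 (Gn Vn Φn : (Fin 2 → ℤ) → ℕ) (Tn c : ℕ) (hΦ : ∀ g u, Φn (gen2 g u) = Φn u)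
    (hV : ∀ g u, Vn (gen2 g u) = Vn u) (R : List (Fin 2 → ℤ)) (G : List (List (Fin 3)))
    (hclos : ∀ u ∈ boxList 2 8, ∃ w ∈ G, applyW2 w u ∈ R)
    (hR : ∀ u ∈ R, c + ((boxList 2 4).map fun z => (Gn (canonK (z - u)) + Tn) * Φn z).sum ≤ Vn u) :
    ∀ u ∈ boxList 2 8, c + ((boxList 2 4).map fun z => (Gn (canonK (z - u)) + Tn) * Φn z).sum ≤ Vn u := by
  intro u hu
  obtain ⟨w, _, hw⟩ := hclos u hu
  have h1 := applyW2_invariant' (fun u => ((boxList 2 4).map fun z => (Gn (canonK (z - u)) + Tn) * Φn z).sum)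
    (fun g u => boxSum_gen2 Gn Φn Tn hΦ g u) w u
  have h2 := applyW2_invariant' Vn hV w u
  have := hR _ hw
  rw [h1, h2] at this
  exact this

/-- **Orbit reduction of the integer certificate** (`[-4,4]^2` → representatives). -/
theorem certZ_of_reps2 (pc : Fin np → List (Fin 2 × Bool)) {pe : Fin np → (Fin 2 → ℤ)}
    (hpe : ∀ σ, pe σ = pend (pc σ)) (W : Fin np → ℕ) {k : ℕ} (hk : 1 ≤ k) {B E : ℕ} (hB : 0 < B)
    (hE : ∀ σ, (pc σ).length + 1 ≤ E) (π₁ π₂ : Fin np ≃ Fin np)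
    (hπ₁ : ∀ σ, pc (π₁ σ) = (pc σ).map (pq (Equiv.swap 0 1)))
    (hπ₂ : ∀ σ, pc (π₂ σ) = (pc σ).map (flipAx 0))
    (hW₁ : ∀ σ, W (π₁ σ) = W σ) (hW₂ : ∀ σ, W (π₂ σ) = W σ)
    (V0n V1n Φn : (Fin 2 → ℤ) → ℕ) (hV0 : ∀ g u, V0n (gen2 g u) = V0n u) (hV1 : ∀ g u, V1n (gen2 g u) = V1n u)
    (hΦ : ∀ g u, Φn (gen2 g u) = Φn u) (DΦ M : ℤ) (R : List (Fin 2 → ℤ)) (G : List (List (Fin 3)))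
    (hclos : ∀ y ∈ boxList 2 4, ∃ w ∈ G, applyW2 w y ∈ R)
    (hR : ∀ y ∈ R, certLHSz pe (S2 pc k) W k 10000 B E V0n V1n y * DΦ ≤ (Φn y : ℤ) * M) :
    ∀ y ∈ boxList 2 4, certLHSz pe (S2 pc k) W k 10000 B E V0n V1n y * DΦ ≤ (Φn y : ℤ) * M := by
  have hV0a : ∀ u, V0n (-u) = V0n u := fun u => by rw [← (gen2_apply u).1]; exact hV0 0 u
  have hV0b : ∀ u, V0n (pv (Equiv.swap 0 1) u) = V0n u := fun u => by rw [← (gen2_apply u).2.1]; exact hV0 1 u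
  have hV1a : ∀ u, V1n (-u) = V1n u := fun u => by rw [← (gen2_apply u).1]; exact hV1 0 u
  have hV1b : ∀ u, V1n (pv (Equiv.swap 0 1) u) = V1n u := fun u => by rw [← (gen2_apply u).2.1]; exact hV1 1 u
  have hV0d : ∀ u, V0n (negC 0 u) = V0n u := fun u => by rw [← (gen2_apply u).2.2]; exact hV0 2 u
  have hV1d : ∀ u, V1n (negC 0 u) = V1n u := fun u => by rw [← (gen2_apply u).2.2]; exact hV1 2 u
  have hS2 : S2 pc k = S pc k := funext fun y => funext fun σ => funext fun σ' => (S_eq_S2 pc k y σ σ').symm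
  rw [hS2] at hR ⊢
  set f : (Fin 2 → ℤ) → ℤ := fun y => certLHSz pe (S pc k) W k 10000 B E V0n V1n y with hf
  -- invariance of the integer functional under the generators, via the real functional
  have hcast : ∀ z, ((f z : ℤ) : ℝ) = certLHS pc (fun σ => (W σ : ℝ) / (1 : ℕ)) k ((10000 : ℕ) / (B : ℝ))
      (fun u => (V0n u : ℝ) / (1 : ℕ)) (fun u => (V1n u : ℝ) / (1 : ℕ)) z *
        ((k : ℝ) * (B : ℝ) ^ E * ((1 : ℕ) : ℝ) ^ 2 * (1 : ℕ)) := fun z =>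
    certLHSz_cast pc hpe W hk 10000 hB hE V0n V1n z Nat.one_pos Nat.one_pos
  have h0 : ∀ z, f (-z) = f z := fun z => by
    apply Int.cast_injective (α := ℝ)
    rw [hcast, hcast, certLHS_neg pc _ k _ (fun u => by simp only [hV0a]) (fun u => by simp only [hV1a])]
  have h1 : ∀ z, f (pv (Equiv.swap 0 1) z) = f z := fun z => by
    apply Int.cast_injective (α := ℝ)
    rw [hcast, hcast, certLHS_perm pc _ k _ (Equiv.swap 0 1) π₁ hπ₁ (fun σ => by simp only [hW₁])
      (fun u => by simp only [hV0b]) (fun u => by simp only [hV1b])]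
  have h3 : ∀ z, f (negC 0 z) = f z := fun z => by
    apply Int.cast_injective (α := ℝ)
    rw [hcast, hcast, certLHS_flip pc _ k _ 0 π₂ hπ₂ (fun σ => by simp only [hW₂])
      (fun u => by simp only [hV0d]) (fun u => by simp only [hV1d])]
  have hgen : ∀ g z, f (gen2 g z) = f z := fun g z => by
    rcases gen2_apply z with ⟨e0, e1, e2⟩
    fin_cases g
    · exact (congr_arg f e0).trans (h0 z)
    · exact (congr_arg f e1).trans (h1 z)
    · exact (congr_arg f e2).trans (h3 z)
  intro y hy
  obtain ⟨w, _, hwR⟩ := hclos y hy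
  have hfy : f (applyW2 w y) = f y := applyW2_invariant' f hgen w y
  have hΦy : Φn (applyW2 w y) = Φn y := applyW2_invariant' Φn hΦ w y
  have := hR _ hwR
  rw [← hΦy]
  rw [hf] at hfy
  simp only at hfy
  rw [← hfy]
  exact this

end Summit.CriticalPhenomena.PercolationContinuityZ3.Theorems.Pcint.BSMX
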